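import Mathlib
import HarnessLib
import HarnessLib.Audit
import Summits.AtomisticToContinuum.Statement
import Literature.Geometry.DiscreteGeometry.KissingPatterns
import Literature.MathematicalPhysics.StatisticalMechanics.BarlowStacking
import HarnessLib.Audit.Status.Attr

/-!
Route: FreeSplittingCertificates

# Route FreeSplittingCertificates — certificates are free, the crystal is their locality —
finite-range pair-splitting certificates for Lennard-Jones and the rigidity of their tight shell

Conforming successor (D-0027 §2.1) of the retired route CrystalSplittingCertificates (closed
2026-08-15T13:41Z, not-a-thesis: its
Assembly concluded the Literature decl instead of `_root_.Crystallization`; refuter review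
rreview-35feb902 folded in), realising card
free-pair-splitting-certificates ("certificates exist for free; the crystal is their continuity") in
finite-N form. A PAIR-SPLITTING RULE
of radius R is a function Φ giving the bond (i,j) of a finite configuration x the weight w_ij =
Φ(x_j − x_i, pattern of x in
B(x_i,R) ∪ B(x_j,R) recentred at x_i) ∈ [0,1] with w_ij + w_ji = 1: every bond's Lennard-Jones
energy is merely SPLIT between its two
ends (no cells, no scores, no other transfers); the weighted site energy is Σ_j w_ij V_LJ(r_ij) and
the threshold is Fekete's constant
e_∞ = inf_M E(M)/M (BlancLewin2015_8_holds, proved). The unrestricted certificate exists for EVERY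
configuration (FreePairSplitting =
Fekete + Gale/Hoffman supply–demand duality), so everything below is a LOCALITY statement. It
suffices to show X = X₁ ∧ X₂:
X₁ (StrictSplittingRule): for every hard core δ > 0 there are R, Φ, an in-layer spacing a and a
c-axis stretch |t| ≤ 1/100 such that Φ
is FEASIBLE on δ-separated configurations (every weighted site energy ≥ e_∞) and STRICT (for every η
> 0 some c > 0 makes "weighted
energy < e_∞ + c" force the first shell, radius 5a/4, to be η-close up to O(3) to the stretched hcp
shell S(a,t));
X₂ (ShellRigidityHcp, rule-free geometry): configurations all of whose first shells inside an L-ball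
are η-close to S(a,t) carry, on
the R'-ball, an ε'-matched window of ONE periodic configuration P.
Lean: `(∀ δ : ℝ, 0 < δ → ∃ (R : ℝ) (Φ : EuclideanSpace ℝ (Fin 3) → Finset (EuclideanSpace ℝ (Fin 3))
→ ℝ) (a t : ℝ), 0 < R ∧ 0 < a ∧ |t| ≤ 1 / 100 ∧ ((∀ v T, 0 ≤ Φ v T ∧ Φ v T ≤ 1) ∧ (∀ v T, v ≠ 0 → Φ
v T + Φ (-v) (T.image fun u => u - v) = 1)) ∧ (∀ (N : ℕ) (x : Fin N → EuclideanSpace ℝ (Fin 3)), (∀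
i j, i ≠ j → δ ≤ dist (x i) (x j)) → ∀ i : Fin N, (⨅ M : ℕ,
Literature.MathematicalPhysics.StatisticalMechanics.groundStateEnergy
Literature.MathematicalPhysics.StatisticalMechanics.lennardJones 3 (M + 1) / ((M + 1 : ℕ) : ℝ)) ≤ ∑
j ∈ Finset.univ.erase i, Φ (x j - x i) ((Finset.univ.filter fun l => dist (x l) (x i) ≤ R ∨ dist (x
l) (x j) ≤ R).image fun l => x l - x i) *
Literature.MathematicalPhysics.StatisticalMechanics.lennardJones (dist (x i) (x j))) ∧ ∀ η : ℝ, 0 <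
η → ∃ c : ℝ, 0 < c ∧ ∀ (N : ℕ) (x : Fin N → EuclideanSpace ℝ (Fin 3)), (∀ i j, i ≠ j → δ ≤ dist (x
i) (x j)) → ∀ k : Fin N, ∑ j ∈ Finset.univ.erase k, Φ (x j - x k) ((Finset.univ.filter fun l => dist
(x l) (x k) ≤ R ∨ dist (x l) (x j) ≤ R).image fun l => x l - x k) *
Literature.MathematicalPhysics.StatisticalMechanics.lennardJones (dist (x k) (x j)) < (⨅ M : ℕ,
Literature.MathematicalPhysics.StatisticalMechanics.groundStateEnergy
Literature.MathematicalPhysics.StatisticalMechanics.lennardJones 3 (M + 1) / ((M + 1 : ℕ) : ℝ)) + c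
→ Literature.Geometry.DiscreteGeometry.ShellCloseTo η ((Finset.univ.filter fun j => j ≠ k ∧ dist (x
j) (x k) ≤ 5 * a / 4).image fun j => x j - x k)
(Literature.Geometry.DiscreteGeometry.hcpKissingPattern.image fun u => a • (u + (t * (u 0 + u 1 + u
2) / 3) • Literature.Geometry.DiscreteGeometry.intVec ![1, 1, 1]))) ∧ (∀ a t : ℝ, 0 < a → |t| ≤ 1 /
100 → ∃ P : Literature.MathematicalPhysics.StatisticalMechanics.PeriodicConfiguration 3, ∀ δ R' ε' :
ℝ, 0 < δ → 0 < R' → 0 < ε' → ∃ η : ℝ, 0 < η ∧ ∃ L : ℝ, ∀ (N : ℕ) (x : Fin N → EuclideanSpace ℝ (Fin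
3)), (∀ i j, i ≠ j → δ ≤ dist (x i) (x j)) → ∀ i : Fin N, (∀ k : Fin N, dist (x k) (x i) ≤ L →
Literature.Geometry.DiscreteGeometry.ShellCloseTo η ((Finset.univ.filter fun j => j ≠ k ∧ dist (x j)
(x k) ≤ 5 * a / 4).image fun j => x j - x k)
(Literature.Geometry.DiscreteGeometry.hcpKissingPattern.image fun u => a • (u + (t * (u 0 + u 1 + u
2) / 3) • Literature.Geometry.DiscreteGeometry.intVec ![1, 1, 1]))) → (∃ q ∈ P.points, ∃ A :
EuclideanSpace ℝ (Fin 3) →ₗᵢ[ℝ] EuclideanSpace ℝ (Fin 3), (∀ p ∈ P.points, dist p q ≤ R' → ∃ j, dist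
(x j) (x i + A (p - q)) ≤ ε') ∧ (∀ j, dist (x j) (x i) ≤ R' → ∃ p ∈ P.points, dist (x j) (x i + A (p
- q)) ≤ ε')))`

## Assembly
StrictSplittingRule and ShellRigidityHcp give, through DefectVanishOfStrict, one periodic P whose
windows are carried by all but o(N)
ground-state sites (analytic inputs: the PROVED tree facts BlancLewin2015_8_holds,
LennardJonesMinimalDistance_holds,
LennardJonesGroundStatesExist_holds); DefectVanishCrystallizes turns this into IsCrystallizing
lennardJones 3 and DefectVanishEnergy
(with PeriodicUpperBound) into HasPeriodicGroundStateEnergy lennardJones 3; their conjunction is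
`_root_.Crystallization`
(abbrev of Literature.MathematicalPhysics.StatisticalMechanics.Crystallization) by definition.
DECIDING THEOREM (glue.lean, sorry-free
in Sketch.lean): `theorem closes (h₁ : StrictSplittingRule) (h₂ : ShellRigidityHcp) (h₃ :
DefectVanishOfStrict)
(h₄ : DefectVanishCrystallizes) (h₅ : DefectVanishEnergy) (h₆ : PeriodicUpperBound) :
_root_.Crystallization` — pure logic
(obtain P from h₃ h₁ h₂; And.intro (h₅ h₆ P hP) (h₄ P hP)). The Assembly item below is the thesis
"X₁ ∧ X₂ suffice"; it is
proved exactly when the four glue supports are. FiniteRangeSplitting and ApproxFiniteRangeSplitting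
are the lower rungs of the
same ladder (Ladder) — staffed because their refutation is the cheapest kill and their proof is the
construction path to
StrictSplittingRule — and are not hypotheses of `closes`.

Rationale: WHY THIS LINE. Mechanism (card free-pair-splitting-certificates): by Fekete E(A) ≥ |A|·e_∞ for every
finite sub-configuration A, which is exactly the
cut condition of Gale's supply–demand theorem / Hoffman's circulation theorem (Gale1957;
BondyMurty2008 Thm 20.9) for splitting each
bond's energy between its ends — so a certificate "every site carries ≥ e_∞" exists for EVERY
configuration with no computation
(FreePairSplitting), and the only thing a Flyspeck/Theil-type local inequality really asserts is
that the splitting can be chosen by a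
BOUNDED-RADIUS RULE (FiniteRangeSplitting) and strictly (StrictSplittingRule). Imports:
network-flow/LP duality for existence;
m-potential / ergodic-optimisation theory (HolsztynskiSlawny1978, Miekisz1998,
GaribaldiThieullen2014) as the frame that names the crux
"regularity of a coboundary" and warns it can fail (ultimate frustration); Hales's layer propagation
(HalesDSP2012 §1.3,
HalesDSP_layerPackings_holds, proved) for X₂; the tree's local-limit criterion
PeriodicConfiguration.tendsto_sum_of_eventually_near'
for the hinge. What it does that other lines do not: the certified quantity is the FULL site energy
with threshold e_∞ itself, so total
slack on ground states is E(N) − N·e_∞ = o(N) for free (no surface term, no periodic-infimum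
bookkeeping), the tight set sees the r⁻⁶
tail and selects the polytype through S(a,t) (ShortRangeStackingBlindness evaded by construction),
and Kreutz–Ziereis-type sitewise
"rigid" energies (arXiv:2604.19239, where such an energy is ASSUMED) would be CONSTRUCTED for
Lennard-Jones. Versus the retired
predecessor: conclusion `_root_.Crystallization`; rule feasibility asked only on δ-separated
configurations (ground states are
δ₀-separated, LennardJonesMinimalDistance_holds, proved — the OneGrainGluing multiplicity witness in
the negatives index is the lesson);
tight shell restricted to the symmetric stretched family S(a,t) (the relaxed LJ hcp keeps P6₃/mmc),
which keeps generic-S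
regular-point-system questions out of X₂; sources for the flow theorem corrected (Gale1957,
BondyMurty2008).

RANKED CRUXES. #2 FiniteRangeSplitting (crux) — (card R3, "finite frustration range") for every δ >
0 there are R > 0 and a pair-splitting rule Φ of radius R (box 0 ≤ Φ ≤ 1; complementarity Φ(v,T) +
Φ(−v, T − v) = 1; the weight of bond (i,j) is Φ(x_j − x_i, {x_l − x_i : dist(x_l,x_i) ≤ R ∨
dist(x_l,x_j) ≤ R})) such that for every N, every δ-separated x : Fin N → ℝ³ and every site i:
Σ_{j≠i} w_ij V_LJ(|x_i − x_j|) ≥ e_∞ := ⨅_M E(M+1)/(M+1). Far bonds are NOT frozen at ½ (Numbers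
(a)); locality = dependence on the two endpoint patterns only; the rule may depend on δ.
[difficulty: open-problem] (why it might fail: Bulk slack is 0: a displaced far atom shifts site
energies at 1st order and only bonds into its R-cluster can respond; local (translation-blind)
displacements cancel nothing, so an exact site-dependent linear design + sitewise phonon coercivity
must exist at some R, or LJ is ultimately frustrated.) [Miekisz1998, HolsztynskiSlawny1978,
GaribaldiThieullen2014, Hales2012, arXiv:1209.6043, BlancLewin2015, arXiv:1504.01153,
Literature.Barriers.AtomisticToContinuum.TetrahedralFrustration,
Literature.Barriers.AtomisticToContinuum.IcosahedralClusters, card:frustration-range-lp-hierarchy]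
#3 StrictSplittingRule (crux) — (card R2/F4 made quantitative; X₁) for every δ > 0 there are R, Φ as
in FiniteRangeSplitting, a spacing a > 0 and a stretch |t| ≤ 1/100 such that Φ is feasible on
δ-separated configurations AND for every η > 0 there is c > 0 with: for every finite δ-separated
configuration and site k, weighted site energy < e_∞ + c ⇒ ShellCloseTo η (first shell of k within
5a/4, recentred) S(a,t), where S(a,t) = a·(hcpKissingPattern stretched by 1+t along its hexagonal
axis (1,1,1)). The certificate selects the polytype (fcc-type sites carry slack ≥ c(η) ≈ e_fcc −
e_hcp, defects much more; near the crystal c(η) ~ κη² is sitewise phonon stability); necessary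
consequence: E(x) − N·e_∞ ≥ c(η)·#(non-η-S sites) for every δ-separated x (linear defect counting).
[deps: FiniteRangeSplitting] [difficulty: open-problem] (why it might fail: Needs relaxed symmetric
hcp (shell S(a,t)) to be the UNIQUE LJ energy-density minimiser with a sitewise gap: fcc-type sites
cost only ~7e-5, so c(eta) <= 7e-5; a tying polytype/FK phase, a symmetry-breaking hcp relaxation,
or no sitewise quadratic stability under bounded-range weights kills it.) [Stillinger2001,
KiharaKoba1952, SchwerdtfegerBurrowsSmits2021, BurrowsCooperSchwerdtfeger2021,
PartayOrtnerCsanyi2017, arXiv:1705.01751, FrieseckeTheil2002, EMing2006, FlatleyTheil2015,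
HalesDSP2012, Literature.Barriers.AtomisticToContinuum.ShortRangeStackingBlindness,
stmt-AtomisticToContinuum-0670]
#4 ShellRigidityHcp (crux) — (X₂, rule-free) for every a > 0 and |t| ≤ 1/100 there is a periodic
configuration P such that for all δ, R', ε' > 0 there are η > 0 and L with: in any finite
δ-separated configuration, a site i all of whose neighbours within L have first shells (radius 5a/4)
η-close to S(a,t) has its R'-window two-sidedly ε'-matched to x_i + A(P.points − q) for some q ∈
P.points and linear isometry A. Intended P = the stretched hcp crystal hcpPeriodicConfiguration a
((1+t)·a·√(2/3)); exact (η = 0, L = ∞, t = 0) case = ExactHcpShellsRigidity (support) via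
HalesDSP_layerPackings_holds; the crux is the stretched layer propagation plus the compactness
upgrade. [difficulty: L] (why it might fail: Exact case = Hales layer argument, in tree only for t =
0 (HalesDSP_layerPackings_holds); stretched (t != 0) propagation and the compactness upgrade (eta ->
0, L -> oo local limits of separated sets) are unproved; near-anticuboctahedral textures escaping
every single P at radius R' would refute it.) [HalesDSP2012, Hales2012, arXiv:1209.6043,
Literature.Geometry.DiscreteGeometry.HalesDSP_layerPackings_holds, KusnerKusnerLagariasShlosman2018,
arXiv:1611.10297, DolbilinLagariasSenechal1998,
Literature.Barriers.AtomisticToContinuum.FlexibleKissingArrangements,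
Literature.Barriers.AtomisticToContinuum.KissingTwelveDegeneracy,
Literature.Barriers.AtomisticToContinuum.DecahedralSoftShell]
#5 ApproxFiniteRangeSplitting (crux) — (lowest rung; card R1 in finite form) for every δ > 0 and ε >
0 there are R(δ,ε) and a rule Φ of radius R with weighted site energy ≥ e_∞ − ε at every site of
every finite δ-separated configuration. FiniteRangeSplitting ⇒ this (Ladder); its refutation for one
(δ, ε) kills the whole line and gives every certificate route an infinite minimal nonlocality; in
Miękisz's lattice examples exactly this rung holds while the exact one fails. Content-ful only for
small ε (Numbers (d)). [difficulty: XL] (why it might fail: False iff some eps0 > 0 is lost by EVERY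
finite-range rule at some site of some delta-separated configuration: an N-uniform duality gap
(quantitative ultimate frustration, Miekisz-type); witness = configuration family whose deficit
regions outrun any fixed radius.) [Miekisz1998, Miekisz1993, KullEtAl2024, Lagarias2002LocalDensity,
BlancLewin2015, card:frustration-range-lp-hierarchy,
Literature.Barriers.AtomisticToContinuum.AperiodicTilingGroundStates,
Literature.Barriers.AtomisticToContinuum.Li2022_cohnElkies3D]
#9 FreePairSplitting (support) — (the card's lemma (2): "certificates are free") for every N and
every injective x : Fin N → ℝ³ there are weights w_ij ≥ 0, w_ij + w_ji = 1 (i ≠ j), with Σ_{j≠i}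
w_ij V_LJ(r_ij) ≥ e_∞ at every site. Proof: Gale's supply–demand theorem / Hoffman's circulation
theorem (BondyMurty2008 Thm 20.9, via Farkas) on the bond graph with arc capacities |V(r_ij)| and
vertex demands e_∞; the cut condition for A ⊆ Fin N is Σ_{inside A} V + Σ_{cross} V⁺ ≥ |A|·e_∞,
implied by E(A) ≥ E(|A|) ≥ |A|·e_∞ (BlancLewin2015_8_holds: e_∞ = inf). Mathlib route: finite LP
duality by hyperplane separation of a finitely generated cone. [difficulty: M] [Gale1957,
BondyMurty2008, BlancLewin2015, arXiv:1504.01153,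
Literature.MathematicalPhysics.StatisticalMechanics.BlancLewin2015_8_holds]
#9 SlackDensity (support) — for any rule (box + complementarity) that is feasible ON GROUND STATES
(every site of every Lennard-Jones ground state has weighted energy ≥ e_∞), and any c > 0, along
every sequence of ground states the fraction of sites with weighted energy ≥ e_∞ + c tends to 0.
Proof: complementarity on realised patterns (T_ji = T_ij − v, v = x_j − x_i ≠ 0) gives Σ_i (weighted
site energy) = interactionEnergy = E(N); E(N) − N·e_∞ = o(N) (BlancLewin2015_8_holds, proved) and
each slack ≥ 0 ⇒ Markov. [difficulty: provable-now] [BlancLewin2015,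
Literature.MathematicalPhysics.StatisticalMechanics.BlancLewin2015_8_holds]
#9 PeriodicUpperBound (support) — e_∞ ≤ e(Q) for every periodic configuration Q of ℝ³: blocks of n³
cells of Q (N = n³·#F distinct points) as trial states; Σ_block site energies = 2N·e(Q) exactly;
cross terms with the exterior: finitely many pairs at distance < 1 per boundary cell (Q is
ρ_Q-separated, PeriodicConfiguration.exists_pos_le_dist) and an attractive tail, together
O(N^(2/3)); e_∞ = inf_M E(M)/M ≤ E(N)/N along these N suffices. Summability from
PeriodicConfigurationSums. Same content as the moot items 0629 + 0714 of CrystalLocalRigidity in the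
e_∞ = ⨅_M E(M+1)/(M+1) normal form. [difficulty: M] [BlancLewin2015, arXiv:1504.01153,
stmt-AtomisticToContinuum-0629, stmt-AtomisticToContinuum-0714,
Literature.MathematicalPhysics.StatisticalMechanics.PeriodicConfiguration.summable_lennardJones_dist_three]
#9 DefectVanishOfStrict (support) — (the glue X₁ → X₂ → hinge) StrictSplittingRule →
ShellRigidityHcp → ∃ P periodic, DefectVanish(P): for all R', ε' > 0, along every ground-state
sequence the fraction of sites whose R'-window is not ε'-matched to a window of P tends to 0. Proof:
δ₀ from LennardJonesMinimalDistance_holds (proved); X₁ at δ₀ gives (R, Φ, a, t), X₂ at (a, t) gives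
P and, for (R', ε', δ₀), (η, L); c = c(η); SlackDensity ⇒ o(N) sites with weighted energy ≥ e_∞ + c,
each spoiling ≤ C(L/δ₀)³ centres (card_le_of_separated_of_dist_le); all other sites meet the
hypothesis of X₂. [difficulty: M] [BlancLewin2015,
Literature.MathematicalPhysics.StatisticalMechanics.LennardJonesMinimalDistance_holds,
Literature.MathematicalPhysics.StatisticalMechanics.card_le_of_separated_of_dist_le]
#9 DefectVanishCrystallizes (support) — for every periodic P, DefectVanish(P) → IsCrystallizing
lennardJones 3: choose R'_k ↑ ∞, ε'_k ↓ 0, indices N_k ↑ and good sites i_k (they exist once the bad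
fraction is < 1), translate by τ_k = −x_{i_k}; q_k reduces modulo the lattice to finitely many motif
points (subsequence: P.points − q_k = P.points − y), A_k → A in O(3) (compact; no rate needed
because the test radius is fixed while k → ∞); then every (R, ε) matching holds eventually for the
translates against A(P − y), a PeriodicConfiguration (CrystallizationSymmetries: translate,
isometryImage), and PeriodicConfiguration.tendsto_sum_of_eventually_near'
(CrystallizationLocalLimit, proved) with the minimal distance of ground states (proved) gives the
vague convergence with m ≡ 1. [difficulty: M] [BlancLewin2015, arXiv:1504.01153,
Literature.MathematicalPhysics.StatisticalMechanics.PeriodicConfiguration.tendsto_sum_of_eventually_near',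
Literature.MathematicalPhysics.StatisticalMechanics.LennardJonesMinimalDistance_holds]
#9 DefectVanishEnergy (support) — PeriodicUpperBound → for every periodic P, DefectVanish(P) →
HasPeriodicGroundStateEnergy lennardJones 3: good sites have site energies within o(1) of the site
energy of their motif class in P (V_LJ uniformly continuous on [δ₀/2, ∞), matching is a local
bijection for ε' < min(δ₀, ρ_P)/3, uniform tails O(R'⁻³) from δ₀-separation: sum_inv_pow_six_le),
bad sites are o(N) with bounded site energy (siteEnergy_nonpos_of_isGroundState and δ₀-separation);
WINDOW AVERAGING: inside a good R'-window the motif classes occur with their natural frequencies up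
to O(1/R'), and classes with different site energies have non-isometric large balls, so the
empirical class frequencies of good sites are asymptotically uniform and E(N)/N → e(P); ground
states exist for all N (LennardJonesGroundStatesExist_holds), E(N)/N → e_∞ (BlancLewin2015_8_holds)
≤ e(Q) ∀ Q gives IsLeast + Tendsto with this P. [difficulty: L] [BlancLewin2015, arXiv:1504.01153,
Literature.MathematicalPhysics.StatisticalMechanics.LennardJonesGroundStatesExist_holds,
Literature.MathematicalPhysics.StatisticalMechanics.BlancLewin2015_8_holds]
#9 ExactHcpShellsRigidity (support) — (η = 0, L = ∞, t = 0 case of ShellRigidityHcp) a nonempty V ⊂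
ℝ³ in which every point's punctured 5a/4-neighbourhood, recentred, is exactly congruent to
a·hcpKissingPattern is an isometric image of hcpStacking a (a√(2/3)). Proof: all distances ≥ a,
rescale by 2/a to a unit-ball packing with HasFccOrHcpShells (all hcp) ⇒
HalesDSP_layerPackings_holds gives a Barlow stacking; anticuboctahedral shells everywhere force the
alternating Hägg sequence (LayerShellPatterns / BarlowCoordination). [difficulty: M] [HalesDSP2012,
Literature.Geometry.DiscreteGeometry.HalesDSP_layerPackings_holds]
#9 Ladder (support) — the rungs are nested: StrictSplittingRule → FiniteRangeSplitting and
FiniteRangeSplitting → ApproxFiniteRangeSplitting (same δ, R, Φ). Pure logic (checked in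
Sketch.lean); records that refuting a lower rung refutes the higher ones. [difficulty: provable-now]
[Miekisz1998]

TWO-LAYER PLAN. Foreseen glued splits (none filed now; k ≤ 3, depth 1). StrictSplittingRule ⇐
NearFieldDesign (an explicit Φ₀ of radius ≈ 2.5a:
Marchal-cell-type splitting of first/second-shell bonds; icosahedral centres import ≈ 0.03–0.06 from
their strained shells) →
FarFieldLinearDesign (bonds longer than R: an EXACT first-order design — the correction −½g_{ij₀}·U
at a zero-slack site i for a
displaced far atom j₀ comes from the bonds of i into the R-cluster of j₀ with i-dependent
coefficients, Σ_k c_k g_ik = g_{ij₀},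
antisymmetrised; the loads dumped on the cluster sum to 0 (force balance, 6̄m2 site symmetry) and
are re-routed inside it;
own-displacement attribution is NOT enough, Numbers (b)) → LocalStability (c(η) ~ κη²: sitewise
quadratic coercivity of relaxed LJ-hcp under bounded-range weights, FrieseckeTheil2002 / EMing2006
type) → StrictSplittingRule.
ShellRigidityHcp ⇐ StretchedLayerPropagation (exact case for all |t| ≤ 1/100; t = 0 is
ExactHcpShellsRigidity, filed) →
CompactnessUpgrade (η_n → 0, L_n → ∞; local limits of δ-separated sets keep exact S(a,t)-shells
because the zone (1.01a + η, 1.3a)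
around every constrained site is empty) → ShellRigidityHcp. FiniteRangeSplitting, if attacked first,
splits by regime: GrossDefects
(non-12-coordinated / strongly strained sites) → NearCrystal (linear + quadratic design) → glue.

KILL CRITERIA. ApproxFiniteRangeSplitting refuted (an ε₀-gap for all radii at some δ) closes the
route outright (close --reason
refuted:ApproxFiniteRangeSplitting) and is a barrier-grade fact for every certificate route.
FiniteRangeSplitting refuted with Approx
standing: close this route (the thesis is then false at the exact level, Miękisz scenario); a
successor would need ε(R)-certificates
plus quantitative rigidity — a different thesis. StrictSplittingRule refuted by a periodic Q with
e(Q) below the symmetric hcp family (certified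
lattice sums, item 0670) or by a symmetry-breaking relaxation of hcp: restate with Q's shell only if
Q is vertex-transitive with one
shell class, else close. ShellRigidityHcp refuted (flexible near-anticuboctahedral textures):
restate with a two-shell S (radius
1.1·√2·a). A refutation elsewhere of CrysPeriodicMinAttained (0627) refutes the conjunct and moots
everything.

NOT DECOMPOSED YET. The construction of Φ (near-field transfers, far-field linear design, quadratic
stability), the radius R (expected 2–3 shells),
the constants c(η), the relaxed hcp parameters (a*, t*) and the certified comparison hcp < fcc,
dhcp, 4H, 6H, 9R (numerics:
Stillinger2001, SchwerdtfegerBurrowsSmits2021, BurrowsCooperSchwerdtfeger2021; certified version =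
item 0670, NOT re-filed here), interval arithmetic, the window-averaging lemma inside
DefectVanishEnergy, and the
card's infinite-volume rungs (equivariant MEASURABLE splittings by Markov–Kakutani, CONTINUOUS ones
by Michael selection: soft, but
they need a hull formalism Lean lacks; motivation, not items). All are layer-2 children once
FiniteRangeSplitting or ShellRigidityHcp
moves. No Target item: X is the conjunction of two filed cruxes.

CHEAPEST FALSIFIER. (i) Lookup + certified lattice sums: relaxed symmetric hcp must be STRICTLY
below fcc and the short-period polytypes for V =
r⁻¹²/12 − r⁻⁶/6 (Stillinger2001, SchwerdtfegerBurrowsSmits2021, BurrowsCooperSchwerdtfeger2021; item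
0670) and phonon-stable against
symmetry-breaking cell distortions — a tie or an instability kills StrictSplittingRule as typed.
(ii) kit LP, one afternoon (first
task per the route review): δ = 0.8, R ∈ {1.5a, 2a, 2.5a}, zoo = Mackay icosahedra 55/147/309, hcp
balls with vacancy /
interstitial / stacking fault / twist boundary / one displaced atom, A15 and Z16 fragments; maximise
the worst site margin τ over
weights forced equal on bonds with identical (v, pattern) up to 1e−3: τ stuck below e_∞ − 1e−3 as R
grows refutes
ApproxFiniteRangeSplitting, hence the line. (iii) Linear algebra, one page: in the perfect relaxed
hcp crystal solve the first-order
sitewise cancellation system for ONE displaced atom at R = 2a (antisymmetrised responses of Φ on the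
13 cluster bonds per far site;
every site balances) — infeasible at every R refutes FiniteRangeSplitting. Hand checks: Numbers
(a)–(d).

NUMBERS. Tree normalisation V(1) = −1/12. Lattice sums A₆ = 14.454, A₁₂ = 12.132 (fcc; hcp A₆ larger
by ≈ 1e−4): a* = (A₁₂/A₆)^(1/6) ≈ 0.9713,
e_∞ ≈ e(hcp) = −A₆²/(24A₁₂) ≈ −0.7176, e_fcc − e_hcp ≈ 7e−5 (tree numerics J₂ ≈ −7.3e−5 on
0670/0716); relaxed hcp c/a within
≈ 1e−4 of √(8/3), so |t*| ≲ 1e−4 ≪ 1/100. First shell: 6 in-plane at a, 6 caps at a·√(1/3 +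
(2/3)(1+t)²) ≤ 1.0067a; second shell 6 at
√2·a ≈ 1.374a (radius 5a/4 separates with margin 0.12a). Icosahedral 13-cluster energy < −3.677
(IcosahedralClusters, tree units):
local first-shell advantage 0.03–0.06 over hcp to be imported within R. Centre slack of an hcp ball
of radius ρ ≈ 0.5ρ⁻³
(ρ_dens = √2/a*³ ≈ 1.54); surface energy E(N) − N·e_∞ ≍ N^(2/3); the route uses only o(N).
DEGENERATE CASES CHECKED BY HAND:
(a) hcp ball of radius ρ + one interstitial at distance D: far weights frozen at ½ over-bind the
centre by ½|V(D)| ≈ D⁻⁶/12 > slack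
0.5ρ⁻³ for R < D < 0.8ρ^(1/2) — frozen far fields are infeasible, endpoint-dependent far weights are
not obstructed; (b) in the
infinite relaxed crystal every site has slack 0 under any feasible rule, so first-order sitewise
terms must cancel identically; for
one atom displaced by U, θ_ij = −½g_ij·(u_i + u_j) cancels sitewise with the TRUE displacement
field, but a pattern-computable
displacement annihilates translations (Σ_cluster u^loc = 0), so the correction vanishes at leading
order — the design needs
site-dependent cluster coefficients (3 equations, 13 unknowns per far site and displaced atom); (c)
N ≤ 2, dilute and piled-up
configurations: trivial or excluded by δ-separation, strictness vacuous for c < 0.6; (d) Φ ≡ ½ gives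
ApproxFiniteRangeSplitting for
ε ≳ a few 1e−2, so only small ε carry content.

DEFINITION REQUESTS. None at open: the rule vocabulary (pattern, weighted site energy, e_∞ = ⨅_M
E(M+1)/(M+1), stretched shell S(a,t), window matching)
is inlined in every item so that all signatures elaborate now (Sketch.lean rc 0, 2026-08-15). If the
route survives grounding, request
`SplittingRule` (structure bundling R, Φ, box, complementarity, with `weight`/`siteEnergy` API) and
`stretchedHcpShell a t` under
Summits/AtomisticToContinuum/Crystallization/Theorems to de-duplicate. Bib: Gale1957 added
(doi:10.2140/pjm.1957.7.1073); the
predecessor's keys Gale1979 / Hoffman1992 denote unrelated papers and are dropped.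

Novelty: Searches (2026-08-15): lit frontier AtomisticToContinuum --since 2020 (30 rows; relevant:
arXiv:2604.19239 Kreutz–Ziereis, sitewise
rigid energies ASSUMED, polycrystal Γ-limit; arXiv:2407.20762, 2-D arbitrary norm); lit vsearch of
the pair-splitting statement and of
"localized energy inequality ⇒ crystallization" (10 + 10 docs, none relevant beyond Ruelle 1969
stability); lit search --hybrid
"Hoffman circulation theorem supply demand cut condition" (BondyMurty2008 Thm 20.9 pp. 443–446,
read); lit galaxy search "ultimate
frustration" --star all and "m-potential" --star pdf (32 + 12 rows, noise); predecessor's searches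
(crossref/zbMATH "ergodic
description of ground states", "ultimate frustration lattice-gas", "max-flow min-cut energy
redistribution certificate packing",
"measurable Hall allocation ground state"; galaxy "calibrated sub-action") found nothing closer;
OpenAlex/S2/arXiv APIs rate-limited
today (recorded in NOTES.md).
Nearest prior art found: HolsztynskiSlawny1978 (doi:10.1007/bf01609493; m-potentials = range-R
certificates on lattices) and Miekisz1998
(ultimate frustration: lattice models where no finite-range m-potential exists although
ε-certificates do); GaribaldiThieullen2014
(doi:10.1007/s10955-014-1139-z; sub-action/calibration regularity for ground states); HalesDSP2012 /
Lagarias2002LocalDensity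
(local density inequalities with transfers, i.e. certificates with hand-designed capacity);
arXiv:2604.19239 (consumes a strict
sitewise energy it assumes).
Delta:  [refs: 10.1007/bf01609493, 10.1007/s10955-014-1139-z, 2604.19239, 2407.20762, doi:10.1007/bf01609493, doi:10.1007/s10955-014-1139-z, BondyMurty2008, HolsztynskiSlawny1978, Miekisz1998, GaribaldiThieullen2014, HalesDSP2012]

Barriers (technique_class: maxflow-mincut-certificates; local-rule transfer; rigidity): - technique_class: maxflow-mincut-certificates; local-rule transfer; rigidity
- Literature.Barriers.AtomisticToContinuum.TetrahedralFrustration: applies to RAW single-cell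
(Rogers/Voronoi) bounds only; a splitting rule is a reapportioning certificate in Lagarias's
admissible class (which contains the successful Hales–Ferguson/Marchal inequalities); re-read as
"the near-field part of Φ must move ≈ 0.03–0.06 per icosahedral centre", which fixes R ≳ 2 shells —
the bet, not a contradiction.
- Literature.Barriers.AtomisticToContinuum.IcosahedralClusters: finite-N icosahedral ground states
are consistent with the line (their centres are deficit sites fed by strained shells; boundary sites
have large slack); calibration data for c(η) and R, and the first entries of the falsifier zoo.
- Literature.Barriers.AtomisticToContinuum.Li2022_cohnElkies3D: a duality gap of the PAIR-MARGINAL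
(Fourier) relaxation; our certificates are configuration-wise and pattern-dependent, not
translation-invariant pair functionals — not met; it warns that low rungs of any hierarchy can
stall, which is exactly what ApproxFiniteRangeSplitting tests.
- Literature.Barriers.AtomisticToContinuum.ShortRangeStackingBlindness: evaded by construction — the
certified quantity is the full site energy Σ_j w_ij V(r_ij) over ALL j, so an fcc-type site inside
any Barlow stacking carries the tail difference (≈ 7e−5) as compulsory slack; the rule's RADIUS is
finite, the certified functional is not truncated.
- Literature.Bar

sub-problem: Crystallization · status: open · opened planner-plancard-AtomisticToContinuum-Crystal-0e276871-g2-0 2026-08-15T18:55:29Z · rev 1 · ledger route-AtomisticToContinuum-FreeSplittingCertificates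
GENERATED by the gate from the ledger (D-0016/17). Provers cite these decls: `theorem foo : Summit.AtomisticToContinuum.Crystallization.Theses.FreeSplittingCertificates.<Decl> := …` in Summits/AtomisticToContinuum/Crystallization/Theorems/<Name>.lean.
-/

namespace Summit.AtomisticToContinuum.Crystallization.Theses.FreeSplittingCertificates

open scoped BigOperators Topology Manifold Classical MeasureTheory ProbabilityTheory Matrix InnerProductSpace ComplexConjugate ContinuousMap
open Filter Set Function TopologicalSpace MeasureTheory

attribute [summit_statement] _root_.Crystallization

/-- item stmt-AtomisticToContinuum-12559 · crux · rank 2 · open · by planner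
why it might fail: Bulk slack is 0: a displaced far atom shifts site energies at 1st order and only bonds into its R-cluster can respond; local (translation-blind) displacements cancel nothing, so an exact site-dependent linear design + sitewise phonon coercivity must exist at some R, or LJ is ultimately frustrated.
sources: Miekisz1998, HolsztynskiSlawny1978, GaribaldiThieullen2014, Hales2012, arXiv:1209.6043, BlancLewin2015
[crux] (card R3, "finite frustration range") for every δ > 0 there are R > 0 and a pair-splitting
rule Φ of radius R (box 0 ≤ Φ ≤ 1; complementarity Φ(v,T) + Φ(−v, T − v) = 1; the weight of bond
(i,j) is Φ(x_j − x_i, {x_l − x_i : dist(x_l,x_i) ≤ R ∨ dist(x_l,x_j) ≤ R})) such that for every N,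
every δ-separated x : Fin N → ℝ³ and every site i: Σ_{j≠i} w_ij V_LJ(|x_i − x_j|) ≥ e_∞ := ⨅_M
E(M+1)/(M+1). Far bonds are NOT frozen at ½ (Numbers (a)); locality = dependence on the two endpoint
patterns only; the rule may depend on δ. [difficulty: open-problem] -/
@[route_item "route-AtomisticToContinuum-FreeSplittingCertificates", crux]
def FiniteRangeSplitting : Prop :=
  ∀ δ : ℝ, 0 < δ → ∃ (R : ℝ) (Φ : EuclideanSpace ℝ (Fin 3) → Finset (EuclideanSpace ℝ (Fin 3)) → ℝ), 0 < R ∧ ((∀ v T, 0 ≤ Φ v T ∧ Φ v T ≤ 1) ∧ (∀ v T, v ≠ 0 → Φ v T + Φ (-v) (T.image fun u => u - v) = 1)) ∧ ∀ (N : ℕ) (x : Fin N → EuclideanSpace ℝ (Fin 3)), (∀ i j, i ≠ j → δ ≤ dist (x i) (x j)) → ∀ i : Fin N, (⨅ M : ℕ, Literature.MathematicalPhysics.StatisticalMechanics.groundStateEnergy Literature.MathematicalPhysics.StatisticalMechanics.lennardJones 3 (M + 1) / ((M + 1 : ℕ) : ℝ)) ≤ ∑ j ∈ Finset.univ.erase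 i, Φ (x j - x i) ((Finset.univ.filter fun l => dist (x l) (x i) ≤ R ∨ dist (x l) (x j) ≤ R).image fun l => x l - x i) * Literature.MathematicalPhysics.StatisticalMechanics.lennardJones (dist (x i) (x j))

/-- item stmt-AtomisticToContinuum-12560 · crux · rank 3 · open · by planner
why it might fail: Needs relaxed symmetric hcp (shell S(a,t)) to be the UNIQUE LJ energy-density minimiser with a sitewise gap: fcc-type sites cost only ~7e-5, so c(eta) <= 7e-5; a tying polytype/FK phase, a symmetry-breaking hcp relaxation, or no sitewise quadratic stability under bounded-range weights kills it.
sources: Stillinger2001, KiharaKoba1952, SchwerdtfegerBurrowsSmits2021, BurrowsCooperSchwerdtfeger2021, PartayOrtnerCsanyi2017, arXiv:1705.01751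
[crux] (card R2/F4 made quantitative; X₁) for every δ > 0 there are R, Φ as in FiniteRangeSplitting,
a spacing a > 0 and a stretch |t| ≤ 1/100 such that Φ is feasible on δ-separated configurations AND
for every η > 0 there is c > 0 with: for every finite δ-separated configuration and site k, weighted
site energy < e_∞ + c ⇒ ShellCloseTo η (first shell of k within 5a/4, recentred) S(a,t), where
S(a,t) = a·(hcpKissingPattern stretched by 1+t along its hexagonal axis (1,1,1)). The certificate
selects the polytype (fcc-type sites carry slack ≥ c(η) ≈ e_fcc − e_hcp, defects much more; near the
crystal c(η) ~ κη² is sitewise phonon stability); necessary consequence: E(x) − N·e_∞ ≥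
c(η)·#(non-η-S sites) for every δ-separated x (linear defect counting). [deps: FiniteRangeSplitting]
[difficulty: open-problem] -/
@[route_item "route-AtomisticToContinuum-FreeSplittingCertificates", crux]
def StrictSplittingRule : Prop :=
  ∀ δ : ℝ, 0 < δ → ∃ (R : ℝ) (Φ : EuclideanSpace ℝ (Fin 3) → Finset (EuclideanSpace ℝ (Fin 3)) → ℝ) (a t : ℝ), 0 < R ∧ 0 < a ∧ |t| ≤ 1 / 100 ∧ ((∀ v T, 0 ≤ Φ v T ∧ Φ v T ≤ 1) ∧ (∀ v T, v ≠ 0 → Φ v T + Φ (-v) (T.image fun u => u - v) = 1)) ∧ (∀ (N : ℕ) (x : Fin N → EuclideanSpace ℝ (Fin 3)), (∀ i j, i ≠ j → δ ≤ dist (x i) (x j)) → ∀ i : Fin N, (⨅ M : ℕ, Literature.MathematicalPhysics.StatisticalMechanics.groundStateEnergy Literature.MathematicalPhysics.StatisticalMechanics.lennardJones 3 (M + 1) / ((M + 1 : ℕ) : ℝ)) ≤ ∑ j ∈ Finset.univ.erase i, Φ (x j - x i) ((Finset.univ.filter fun l => dist (x l) (x i) ≤ R ∨ dist (x l) (x j)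 ≤ R).image fun l => x l - x i) * Literature.MathematicalPhysics.StatisticalMechanics.lennardJones (dist (x i) (x j))) ∧ ∀ η : ℝ, 0 < η → ∃ c : ℝ, 0 < c ∧ ∀ (N : ℕ) (x : Fin N → EuclideanSpace ℝ (Fin 3)), (∀ i j, i ≠ j → δ ≤ dist (x i) (x j)) → ∀ k : Fin N, ∑ j ∈ Finset.univ.erase k, Φ (x j - x k) ((Finset.univ.filter fun l => dist (x l) (x k) ≤ R ∨ dist (x l) (x j) ≤ R).image fun l => x l - x k) * Literature.MathematicalPhysics.StatisticalMechanics.lennardJones (dist (x k) (x j)) < (⨅ M : ℕ, Literature.MathematicalPhysics.StatisticalMechanics.groundStateEnergy Literature.MathematicalPhysics.StatisticalMechanics.lennardJones 3 (M + 1) / ((M + 1 : ℕ) : ℝ)) + c → Literature.Geometry.DiscreteGeometry.ShellCloseTo η ((Finset.univ.filter fun j => j ≠ k ∧ dist (x j) (x k) ≤ 5 * a / 4).image fun j => x j - x k) (Literature.Geometry.DiscreteGeometry.hcpKissingPattern.image fun u => a • (u + (t * (u 0 + u 1 + u 2) / 3) • Literature.Geometry.DiscreteGeometry.intVec ![1,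 1, 1]))

/-- item stmt-AtomisticToContinuum-12561 · crux · rank 4 · open · by planner
why it might fail: Exact case = Hales layer argument, in tree only for t = 0 (HalesDSP_layerPackings_holds); stretched (t != 0) propagation and the compactness upgrade (eta -> 0, L -> oo local limits of separated sets) are unproved; near-anticuboctahedral textures escaping every single P at radius R' would refute it.
sources: HalesDSP2012, Hales2012, arXiv:1209.6043, Literature.Geometry.DiscreteGeometry.HalesDSP_layerPackings_holds, KusnerKusnerLagariasShlosman2018, arXiv:1611.10297
[crux] (X₂, rule-free) for every a > 0 and |t| ≤ 1/100 there is a periodic configuration P such that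
for all δ, R', ε' > 0 there are η > 0 and L with: in any finite δ-separated configuration, a site i
all of whose neighbours within L have first shells (radius 5a/4) η-close to S(a,t) has its R'-window
two-sidedly ε'-matched to x_i + A(P.points − q) for some q ∈ P.points and linear isometry A.
Intended P = the stretched hcp crystal hcpPeriodicConfiguration a ((1+t)·a·√(2/3)); exact (η = 0, L
= ∞, t = 0) case = ExactHcpShellsRigidity (support) via HalesDSP_layerPackings_holds; the crux is
the stretched layer propagation plus the compactness upgrade. [difficulty: L] -/
@[route_item "route-AtomisticToContinuum-FreeSplittingCertificates", crux]
def ShellRigidityHcp : Prop :=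
  ∀ a t : ℝ, 0 < a → |t| ≤ 1 / 100 → ∃ P : Literature.MathematicalPhysics.StatisticalMechanics.PeriodicConfiguration 3, ∀ δ R' ε' : ℝ, 0 < δ → 0 < R' → 0 < ε' → ∃ η : ℝ, 0 < η ∧ ∃ L : ℝ, ∀ (N : ℕ) (x : Fin N → EuclideanSpace ℝ (Fin 3)), (∀ i j, i ≠ j → δ ≤ dist (x i) (x j)) → ∀ i : Fin N, (∀ k : Fin N, dist (x k) (x i) ≤ L → Literature.Geometry.DiscreteGeometry.ShellCloseTo η ((Finset.univ.filter fun j => j ≠ k ∧ dist (x j) (x k) ≤ 5 * a / 4).image fun j => x j - x k) (Literature.Geometry.DiscreteGeometry.hcpKissingPattern.image fun u => a • (u + (t * (u 0 + u 1 + u 2) / 3) • Literature.Geometry.DiscreteGeometry.intVec ![1, 1, 1]))) → (∃ q ∈ P.points, ∃ A : EuclideanSpace ℝ (Fin 3) →ₗᵢ[ℝ] EuclideanSpace ℝ (Fin 3), (∀ p ∈ P.points, dist p q ≤ R' → ∃ j, dist (x j) (x i + A (p - q)) ≤ ε') ∧ (∀ j, dist (x j) (x i) ≤ R' → ∃ p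 ∈ P.points, dist (x j) (x i + A (p - q)) ≤ ε'))

/-- item stmt-AtomisticToContinuum-12562 · crux · rank 5 · open · by planner
why it might fail: False iff some eps0 > 0 is lost by EVERY finite-range rule at some site of some delta-separated configuration: an N-uniform duality gap (quantitative ultimate frustration, Miekisz-type); witness = configuration family whose deficit regions outrun any fixed radius.
sources: Miekisz1998, Miekisz1993, KullEtAl2024, Lagarias2002LocalDensity, BlancLewin2015, card:frustration-range-lp-hierarchy
[crux] (lowest rung; card R1 in finite form) for every δ > 0 and ε > 0 there are R(δ,ε) and a rule Φ
of radius R with weighted site energy ≥ e_∞ − ε at every site of every finite δ-separated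
configuration. FiniteRangeSplitting ⇒ this (Ladder); its refutation for one (δ, ε) kills the whole
line and gives every certificate route an infinite minimal nonlocality; in Miękisz's lattice
examples exactly this rung holds while the exact one fails. Content-ful only for small ε (Numbers
(d)). [difficulty: XL] -/
@[route_item "route-AtomisticToContinuum-FreeSplittingCertificates"]
def ApproxFiniteRangeSplitting : Prop :=
  ∀ δ : ℝ, 0 < δ → ∀ ε : ℝ, 0 < ε → ∃ (R : ℝ) (Φ : EuclideanSpace ℝ (Fin 3) → Finset (EuclideanSpace ℝ (Fin 3)) → ℝ), 0 < R ∧ ((∀ v T, 0 ≤ Φ v T ∧ Φ v T ≤ 1) ∧ (∀ v T, v ≠ 0 → Φ v T + Φ (-v) (T.image fun u => u - v) = 1)) ∧ ∀ (N : ℕ) (x : Fin N → EuclideanSpace ℝ (Fin 3)), (∀ i j, i ≠ j → δ ≤ dist (x i) (x j)) → ∀ i : Fin N, (⨅ M : ℕ, Literature.MathematicalPhysics.StatisticalMechanics.groundStateEnergy Literature.MathematicalPhysics.StatisticalMechanics.lennardJones 3 (M + 1) / ((M + 1 : ℕ) : ℝ)) - ε ≤ ∑ j ∈ Finset.univ.erase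 i, Φ (x j - x i) ((Finset.univ.filter fun l => dist (x l) (x i) ≤ R ∨ dist (x l) (x j) ≤ R).image fun l => x l - x i) * Literature.MathematicalPhysics.StatisticalMechanics.lennardJones (dist (x i) (x j))

/-- item stmt-AtomisticToContinuum-12563 · support · rank 9 · closed · proved by Summit.AtomisticToContinuum.Crystallization.Theorems.freePairSplitting_proof @ 0cd248dbd2fe (prover) · by planner
sources: Gale1957, BondyMurty2008, BlancLewin2015, arXiv:1504.01153, Literature.MathematicalPhysics.StatisticalMechanics.BlancLewin2015_8_holds
[support] (the card's lemma (2): "certificates are free") for every N and every injective x : Fin N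
→ ℝ³ there are weights w_ij ≥ 0, w_ij + w_ji = 1 (i ≠ j), with Σ_{j≠i} w_ij V_LJ(r_ij) ≥ e_∞ at
every site. Proof: Gale's supply–demand theorem / Hoffman's circulation theorem (BondyMurty2008 Thm
20.9, via Farkas) on the bond graph with arc capacities |V(r_ij)| and vertex demands e_∞; the cut
condition for A ⊆ Fin N is Σ_{inside A} V + Σ_{cross} V⁺ ≥ |A|·e_∞, implied by E(A) ≥ E(|A|) ≥
|A|·e_∞ (BlancLewin2015_8_holds: e_∞ = inf). Mathlib route: finite LP duality by hyperplane
separation of a finitely generated cone. [difficulty: M] -/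
@[route_item "route-AtomisticToContinuum-FreeSplittingCertificates"]
def FreePairSplitting : Prop :=
  ∀ (N : ℕ) (x : Fin N → EuclideanSpace ℝ (Fin 3)), Function.Injective x → ∃ w : Fin N → Fin N → ℝ, (∀ i j, i ≠ j → 0 ≤ w i j ∧ w i j + w j i = 1) ∧ ∀ i, (⨅ M : ℕ, Literature.MathematicalPhysics.StatisticalMechanics.groundStateEnergy Literature.MathematicalPhysics.StatisticalMechanics.lennardJones 3 (M + 1) / ((M + 1 : ℕ) : ℝ)) ≤ ∑ j ∈ Finset.univ.erase i, w i j * Literature.MathematicalPhysics.StatisticalMechanics.lennardJones (dist (x i) (x j))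

/-- item stmt-AtomisticToContinuum-12564 · support · rank 9 · closed · proved by Summit.AtomisticToContinuum.Crystallization.Theorems.slackDensity_proof @ cbdcc04c67d9 (prover) · by planner
sources: BlancLewin2015, Literature.MathematicalPhysics.StatisticalMechanics.BlancLewin2015_8_holds
[support] for any rule (box + complementarity) that is feasible ON GROUND STATES (every site of
every Lennard-Jones ground state has weighted energy ≥ e_∞), and any c > 0, along every sequence of
ground states the fraction of sites with weighted energy ≥ e_∞ + c tends to 0. Proof:
complementarity on realised patterns (T_ji = T_ij − v, v = x_j − x_i ≠ 0) gives Σ_i (weighted site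
energy) = interactionEnergy = E(N); E(N) − N·e_∞ = o(N) (BlancLewin2015_8_holds, proved) and each
slack ≥ 0 ⇒ Markov. [difficulty: provable-now] -/
@[route_item "route-AtomisticToContinuum-FreeSplittingCertificates"]
def SlackDensity : Prop :=
  ∀ (R : ℝ) (Φ : EuclideanSpace ℝ (Fin 3) → Finset (EuclideanSpace ℝ (Fin 3)) → ℝ), ((∀ v T, 0 ≤ Φ v T ∧ Φ v T ≤ 1) ∧ (∀ v T, v ≠ 0 → Φ v T + Φ (-v) (T.image fun u => u - v) = 1)) → (∀ (N : ℕ) (x : Fin N → EuclideanSpace ℝ (Fin 3)), Literature.MathematicalPhysics.StatisticalMechanics.IsGroundState Literature.MathematicalPhysics.StatisticalMechanics.lennardJones x → ∀ i : Fin N, (⨅ M : ℕ, Literature.MathematicalPhysics.StatisticalMechanics.groundStateEnergy Literature.MathematicalPhysics.StatisticalMechanics.lennardJones 3 (M + 1) / ((M + 1 : ℕ) : ℝ)) ≤ ∑ j ∈ Finset.univ.erase i, Φ (x j - x i) ((Finset.univ.filter fun l => dist (x l) (x i) ≤ R ∨ dist (x l) (x j) ≤ R).image fun l => x l - x i) *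 Literature.MathematicalPhysics.StatisticalMechanics.lennardJones (dist (x i) (x j))) → ∀ c : ℝ, 0 < c → ∀ x : (N : ℕ) → (Fin N → EuclideanSpace ℝ (Fin 3)), (∀ N, Literature.MathematicalPhysics.StatisticalMechanics.IsGroundState Literature.MathematicalPhysics.StatisticalMechanics.lennardJones (x N)) → Filter.Tendsto (fun N : ℕ => (Nat.card {k : Fin N // (⨅ M : ℕ, Literature.MathematicalPhysics.StatisticalMechanics.groundStateEnergy Literature.MathematicalPhysics.StatisticalMechanics.lennardJones 3 (M + 1) / ((M + 1 : ℕ) : ℝ)) + c ≤ ∑ j ∈ Finset.univ.erase k, Φ (x N j - x N k) ((Finset.univ.filter fun l => dist (x N l) (x N k) ≤ R ∨ dist (x N l) (x N j) ≤ R).image fun l => x N l - x N k) * Literature.MathematicalPhysics.StatisticalMechanics.lennardJones (dist (x N k) (x N j))} : ℝ) / N) Filter.atTop (nhds 0)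

/-- item stmt-AtomisticToContinuum-12565 · support · rank 9 · closed · proved by Summit.AtomisticToContinuum.Crystallization.Theorems.periodicUpperBound_proof @ 599c8893be48 (prover) · by planner
sources: BlancLewin2015, arXiv:1504.01153, stmt-AtomisticToContinuum-0629, stmt-AtomisticToContinuum-0714, Literature.MathematicalPhysics.StatisticalMechanics.PeriodicConfiguration.summable_lennardJones_dist_three
[support] e_∞ ≤ e(Q) for every periodic configuration Q of ℝ³: blocks of n³ cells of Q (N = n³·#F
distinct points) as trial states; Σ_block site energies = 2N·e(Q) exactly; cross terms with the
exterior: finitely many pairs at distance < 1 per boundary cell (Q is ρ_Q-separated,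
PeriodicConfiguration.exists_pos_le_dist) and an attractive tail, together O(N^(2/3)); e_∞ = inf_M
E(M)/M ≤ E(N)/N along these N suffices. Summability from PeriodicConfigurationSums. Same content as
the moot items 0629 + 0714 of CrystalLocalRigidity in the e_∞ = ⨅_M E(M+1)/(M+1) normal form.
[difficulty: M] -/
@[route_item "route-AtomisticToContinuum-FreeSplittingCertificates", crux]
def PeriodicUpperBound : Prop :=
  ∀ Q : Literature.MathematicalPhysics.StatisticalMechanics.PeriodicConfiguration 3, (⨅ M : ℕ, Literature.MathematicalPhysics.StatisticalMechanics.groundStateEnergy Literature.MathematicalPhysics.StatisticalMechanics.lennardJones 3 (M + 1) / ((M + 1 : ℕ) : ℝ)) ≤ Q.energyPerParticle Literature.MathematicalPhysics.StatisticalMechanics.lennardJones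

/-- item stmt-AtomisticToContinuum-12566 · support · rank 9 · closed · proved by Summit.AtomisticToContinuum.Crystallization.Theorems.defectVanishOfStrict_proof @ c72aee93d46f (prover) · by planner
sources: BlancLewin2015, Literature.MathematicalPhysics.StatisticalMechanics.LennardJonesMinimalDistance_holds, Literature.MathematicalPhysics.StatisticalMechanics.card_le_of_separated_of_dist_le
[support] (the glue X₁ → X₂ → hinge) StrictSplittingRule → ShellRigidityHcp → ∃ P periodic,
DefectVanish(P): for all R', ε' > 0, along every ground-state sequence the fraction of sites whose
R'-window is not ε'-matched to a window of P tends to 0. Proof: δ₀ from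
LennardJonesMinimalDistance_holds (proved); X₁ at δ₀ gives (R, Φ, a, t), X₂ at (a, t) gives P and,
for (R', ε', δ₀), (η, L); c = c(η); SlackDensity ⇒ o(N) sites with weighted energy ≥ e_∞ + c, each
spoiling ≤ C(L/δ₀)³ centres (card_le_of_separated_of_dist_le); all other sites meet the hypothesis
of X₂. [difficulty: M] -/
@[route_item "route-AtomisticToContinuum-FreeSplittingCertificates", crux]
def DefectVanishOfStrict : Prop :=
  StrictSplittingRule → ShellRigidityHcp → ∃ P : Literature.MathematicalPhysics.StatisticalMechanics.PeriodicConfiguration 3, (∀ R' ε' : ℝ, 0 < R' → 0 < ε' → ∀ x : (N : ℕ) → (Fin N → EuclideanSpace ℝ (Fin 3)), (∀ N, Literature.MathematicalPhysics.StatisticalMechanics.IsGroundState Literature.MathematicalPhysics.StatisticalMechanics.lennardJones (x N)) → Filter.Tendsto (fun N : ℕ => (Nat.card {i : Fin N // ¬ (∃ q ∈ P.points, ∃ A : EuclideanSpace ℝ (Fin 3) →ₗᵢ[ℝ] EuclideanSpace ℝ (Fin 3), (∀ p ∈ P.points, dist p q ≤ R' → ∃ j, dist (x N j) (x N i + A (p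 - q)) ≤ ε') ∧ (∀ j, dist (x N j) (x N i) ≤ R' → ∃ p ∈ P.points, dist (x N j) (x N i + A (p - q)) ≤ ε'))} : ℝ) / N) Filter.atTop (nhds 0))

/-- item stmt-AtomisticToContinuum-12567 · support · rank 9 · closed · proved by Summit.AtomisticToContinuum.Crystallization.Theorems.FreeSplittingCertificatesDefectVanishCrystallizes.defectVanishCrystallizes_proof @ 4b28c05a5d6f (prover) · by planner
sources: BlancLewin2015, arXiv:1504.01153, Literature.MathematicalPhysics.StatisticalMechanics.PeriodicConfiguration.tendsto_sum_of_eventually_near', Literature.MathematicalPhysics.StatisticalMechanics.LennardJonesMinimalDistance_holds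
[support] for every periodic P, DefectVanish(P) → IsCrystallizing lennardJones 3: choose R'_k ↑ ∞,
ε'_k ↓ 0, indices N_k ↑ and good sites i_k (they exist once the bad fraction is < 1), translate by
τ_k = −x_{i_k}; q_k reduces modulo the lattice to finitely many motif points (subsequence: P.points
− q_k = P.points − y), A_k → A in O(3) (compact; no rate needed because the test radius is fixed
while k → ∞); then every (R, ε) matching holds eventually for the translates against A(P − y), a
PeriodicConfiguration (CrystallizationSymmetries: translate, isometryImage), and
PeriodicConfiguration.tendsto_sum_of_eventually_near' (CrystallizationLocalLimit, proved) with the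
minimal distance of ground states (proved) gives the vague convergence with m ≡ 1. [difficulty: M] -/
@[route_item "route-AtomisticToContinuum-FreeSplittingCertificates", crux]
def DefectVanishCrystallizes : Prop :=
  ∀ P : Literature.MathematicalPhysics.StatisticalMechanics.PeriodicConfiguration 3, (∀ R' ε' : ℝ, 0 < R' → 0 < ε' → ∀ x : (N : ℕ) → (Fin N → EuclideanSpace ℝ (Fin 3)), (∀ N, Literature.MathematicalPhysics.StatisticalMechanics.IsGroundState Literature.MathematicalPhysics.StatisticalMechanics.lennardJones (x N)) → Filter.Tendsto (fun N : ℕ => (Nat.card {i : Fin N // ¬ (∃ q ∈ P.points, ∃ A : EuclideanSpace ℝ (Fin 3) →ₗᵢ[ℝ] EuclideanSpace ℝ (Fin 3), (∀ p ∈ P.points, dist p q ≤ R' → ∃ j, dist (x N j) (x N i + A (p - q)) ≤ ε') ∧ (∀ j, dist (x N j) (x N i) ≤ R' → ∃ p ∈ P.points, dist (x N j) (x N i + A (p - q)) ≤ ε'))} : ℝ) / N) Filter.atTop (nhds 0)) → Literature.MathematicalPhysics.StatisticalMechanics.IsCrystallizing Literature.MathematicalPhysics.StatisticalMechanics.lennardJones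 3

/-- item stmt-AtomisticToContinuum-12568 · support · rank 9 · closed · proved by Summit.AtomisticToContinuum.Crystallization.Theorems.defectVanishEnergy_proof @ 58c93dc08ce3 (prover) · by planner
sources: BlancLewin2015, arXiv:1504.01153, Literature.MathematicalPhysics.StatisticalMechanics.LennardJonesGroundStatesExist_holds, Literature.MathematicalPhysics.StatisticalMechanics.BlancLewin2015_8_holds
[support] PeriodicUpperBound → for every periodic P, DefectVanish(P) → HasPeriodicGroundStateEnergy
lennardJones 3: good sites have site energies within o(1) of the site energy of their motif class in
P (V_LJ uniformly continuous on [δ₀/2, ∞), matching is a local bijection for ε' < min(δ₀, ρ_P)/3,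
uniform tails O(R'⁻³) from δ₀-separation: sum_inv_pow_six_le), bad sites are o(N) with bounded site
energy (siteEnergy_nonpos_of_isGroundState and δ₀-separation); WINDOW AVERAGING: inside a good
R'-window the motif classes occur with their natural frequencies up to O(1/R'), and classes with
different site energies have non-isometric large balls, so the empirical class frequencies of good
sites are asymptotically uniform and E(N)/N → e(P); ground states exist for all N
(LennardJonesGroundStatesExist_holds), E(N)/N → e_∞ (BlancLewin2015_8_holds) ≤ e(Q) ∀ Q gives
IsLeast + Tendsto with this P. [difficulty: L] -/
@[route_item "route-AtomisticToContinuum-FreeSplittingCertificates", crux]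
def DefectVanishEnergy : Prop :=
  (∀ Q : Literature.MathematicalPhysics.StatisticalMechanics.PeriodicConfiguration 3, (⨅ M : ℕ, Literature.MathematicalPhysics.StatisticalMechanics.groundStateEnergy Literature.MathematicalPhysics.StatisticalMechanics.lennardJones 3 (M + 1) / ((M + 1 : ℕ) : ℝ)) ≤ Q.energyPerParticle Literature.MathematicalPhysics.StatisticalMechanics.lennardJones) → ∀ P : Literature.MathematicalPhysics.StatisticalMechanics.PeriodicConfiguration 3, (∀ R' ε' : ℝ, 0 < R' → 0 < ε' → ∀ x : (N : ℕ) → (Fin N → EuclideanSpace ℝ (Fin 3)), (∀ N, Literature.MathematicalPhysics.StatisticalMechanics.IsGroundState Literature.MathematicalPhysics.StatisticalMechanics.lennardJones (x N)) → Filter.Tendsto (fun N : ℕ => (Nat.card {i : Fin N // ¬ (∃ q ∈ P.points, ∃ A : EuclideanSpace ℝ (Fin 3) →ₗᵢ[ℝ] EuclideanSpace ℝ (Fin 3), (∀ p ∈ P.points, dist p q ≤ R' → ∃ j, dist (x N j) (x N i + A (p - q)) ≤ ε') ∧ (∀ j, dist (x N j) (x N i) ≤ R' → ∃ p ∈ P.points,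 dist (x N j) (x N i + A (p - q)) ≤ ε'))} : ℝ) / N) Filter.atTop (nhds 0)) → Literature.MathematicalPhysics.StatisticalMechanics.HasPeriodicGroundStateEnergy Literature.MathematicalPhysics.StatisticalMechanics.lennardJones 3

/-- item stmt-AtomisticToContinuum-12569 · support · rank 9 · closed · proved by Summit.AtomisticToContinuum.Crystallization.Theorems.exactHcpShellsRigidity_proof @ 98fbf36d5a5c (prover) · by planner
sources: HalesDSP2012, Literature.Geometry.DiscreteGeometry.HalesDSP_layerPackings_holds
[support] (η = 0, L = ∞, t = 0 case of ShellRigidityHcp) a nonempty V ⊂ ℝ³ in which every point's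
punctured 5a/4-neighbourhood, recentred, is exactly congruent to a·hcpKissingPattern is an isometric
image of hcpStacking a (a√(2/3)). Proof: all distances ≥ a, rescale by 2/a to a unit-ball packing
with HasFccOrHcpShells (all hcp) ⇒ HalesDSP_layerPackings_holds gives a Barlow stacking;
anticuboctahedral shells everywhere force the alternating Hägg sequence (LayerShellPatterns /
BarlowCoordination). [difficulty: M] -/
@[route_item "route-AtomisticToContinuum-FreeSplittingCertificates"]
def ExactHcpShellsRigidity : Prop :=
  ∀ a : ℝ, 0 < a → ∀ V : Set (EuclideanSpace ℝ (Fin 3)), V.Nonempty → (∀ v ∈ V, ∃ T : Finset (EuclideanSpace ℝ (Fin 3)), (↑T : Set (EuclideanSpace ℝ (Fin 3))) = (fun u => u - v) '' {u ∈ V | u ≠ v ∧ dist u v ≤ 5 * a / 4} ∧ Literature.Geometry.DiscreteGeometry.ShellCloseTo 0 T (Literature.Geometry.DiscreteGeometry.hcpKissingPattern.image fun u => a • u)) → ∃ g : EuclideanSpace ℝ (Fin 3) ≃ᵢ EuclideanSpace ℝ (Fin 3), V = g '' Literature.MathematicalPhysics.StatisticalMechanics.hcpStacking a (a * Real.sqrt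 (2 / 3))

/-- item stmt-AtomisticToContinuum-12570 · support · rank 9 · closed · proved by Summit.AtomisticToContinuum.Crystallization.Theorems.ladder_proof @ 0ea98118b10f (prover) · by planner
sources: Miekisz1998
[support] the rungs are nested: StrictSplittingRule → FiniteRangeSplitting and FiniteRangeSplitting
→ ApproxFiniteRangeSplitting (same δ, R, Φ). Pure logic (checked in Sketch.lean); records that
refuting a lower rung refutes the higher ones. [difficulty: provable-now] -/
@[route_item "route-AtomisticToContinuum-FreeSplittingCertificates"]
def Ladder : Prop :=
  (StrictSplittingRule → FiniteRangeSplitting) ∧ (FiniteRangeSplitting → ApproxFiniteRangeSplitting)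

/-- item stmt-AtomisticToContinuum-12571 · assembly · rank 1 · closed · proved by Summit.AtomisticToContinuum.Crystallization.Theorems.freeSplittingCertificates_assembly_proof @ eda7ceab7090 (prover) · by planner
sources: BlancLewin2015, arXiv:1504.01153
[assembly] StrictSplittingRule → ShellRigidityHcp → Crystallization (via DefectVanishOfStrict,
DefectVanishCrystallizes, DefectVanishEnergy, PeriodicUpperBound). -/
@[route_item "route-AtomisticToContinuum-FreeSplittingCertificates"]
def Assembly : Prop :=
  StrictSplittingRule → ShellRigidityHcp → _root_.Crystallization

/-! D-0027 §2.1 — DECIDING THEOREM (planner-authored via `route open/edit --closes-file`; by planner-plancard-AtomisticToContinuum-Crystal-0e276871-g2-0 2026-08-15T18:55:29Z):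
its hypotheses are this route's items and its conclusion the sub-problem Statement (glue_lint), and it elaborates with this file. -/

@[closes "route-AtomisticToContinuum-FreeSplittingCertificates"] theorem closes (h₁ : StrictSplittingRule) (h₂ : ShellRigidityHcp) (h₃ : DefectVanishOfStrict)
    (h₄ : DefectVanishCrystallizes) (h₅ : DefectVanishEnergy) (h₆ : PeriodicUpperBound) :
    _root_.Crystallization := by
  obtain ⟨P, hP⟩ := h₃ h₁ h₂
  show Literature.MathematicalPhysics.StatisticalMechanics.HasPeriodicGroundStateEnergy
      Literature.MathematicalPhysics.StatisticalMechanics.lennardJones 3 ∧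
    Literature.MathematicalPhysics.StatisticalMechanics.IsCrystallizing
      Literature.MathematicalPhysics.StatisticalMechanics.lennardJones 3
  exact ⟨h₅ h₆ P hP, h₄ P hP⟩

end Summit.AtomisticToContinuum.Crystallization.Theses.FreeSplittingCertificates
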